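import Summits.HubbardSuperconductivity.HubbardSuperconductivity.Theorems.ThermalWedgeTwTipContinuationDanskinAttainment

/-!
# `TwTipContinuation` (stmt-HubbardSuperconductivity-1700), line `isogap-submodular-transport`:
# NORMAL FORM of the lead's stub `stub_isogapTransport` (what the crux-sized stub really says)

Seeded family `H_L(U,g) = hubbardTorus 2 L 1 U − (g/L²)P_L`, `P_L = (pairField d L)ᴴ(pairField d L)`, sector
`szSector (2n) 0`, `E_L(U,g) = minEnergyOn (H_L(U,g)) (szSector (2n) 0)`. The STRIP transport inequality of the
line,
  `E_L(0,c) − E_L(0,c+s) − ε s L² ≤ E_L(U,0) − E_L(U,s)` for all seeds `s ∈ (0,s₁]` (`c = aU²` the isogap shift),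
is pinned between two ORDER-DOMINANCE statements about single ground states (chords + Danskin):

* `transport_of_orderDominance` — SUFFICIENT: if some normalised sector ground state `ψ` of the PURE torus
  dominates, up to `εL⁴`, the pair intensity of some normalised ground state `φ` of the free seeded torus at the
  TOP seed `c + s₁`, then the transport inequality holds for every `s ∈ (0,s₁]` (left chord on the free edge at
  `c+s`, monotonicity of the ground-state order in the seed, right chord at the pure corner);
* `orderDominance_of_transport` — NECESSARY: the transport inequality for `s ∈ (0,s₁]` forces, for EVERY
  normalised ground state `φ` of the free seeded torus at the BOTTOM seed `c`, a normalised sector ground state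
  `ψ` of the pure torus with `re⟨φ,P_Lφ⟩ ≤ re⟨ψ,P_Lψ⟩ + εL⁴` (right chord on the free edge at `c`, then the landed
  Danskin attainment `stub_danskinAttainment` at the pure corner);
* `stub_isogapTransport_of_orderDominance`, `orderDominance_of_stub_isogapTransport` — the same with the stub's
  quantifier prefix (`∃ δ ∈ [1/10,3/10], ∃ U₁ a > 0, ∀ U ∈ (0,U₁], …, eventually in even L`).

So, eventually in `L` and up to the shift `c ↔ c + s₁` on the (exactly ordered) free edge, `stub_isogapTransport`
IS the statement "for every small `U` the pure torus has SOME sector ground state whose d-wave pair intensity is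
at least the reduced-BCS one at seed `≈ aU²`" — the `∃`-ground-state weak-coupling d-wave order floor with a
BCS-calibrated constant (Kohn–Luttinger as a theorem); nothing weaker hides in the energy formulation. Folklore
bookkeeping over the landed chords (`Negative/SeededChords`) and Danskin attainment; no definition is introduced.
-/

noncomputable section

namespace Summit.HubbardSuperconductivity.TwTipContinuation.IsogapTransport

open Matrix Filter Finset
open Literature.MathematicalPhysics.QuantumLattice Literature.Probability.LatticeModels
open Summit.HubbardSuperconductivity.TwTipContinuation.Negative
open scoped ComplexOrder

/-- **Order dominance at the top seed ⇒ strip transport.** Fix a side `L`, a coupling `U`, a free-edge seed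
`c`, a strip width `s₁` and `ε`. If `ψ` is a normalised sector ground state of the pure torus
`hubbardTorus 2 L 1 U`, `φ` a normalised sector ground state of the free seeded torus at seed `c + s₁`, and
`re⟨φ,P_Lφ⟩ ≤ re⟨ψ,P_Lψ⟩ + εL⁴`, then for every `s ∈ (0,s₁]`
`E_L(0,c) − E_L(0,c+s) − ε s L² ≤ E_L(U,0) − E_L(U,s)`. [folklore] -/
theorem transport_of_orderDominance {L : ℕ} [NeZero L] {U c s₁ ε : ℝ} {n : ℕ}
    {ψ φ : Fock (Orb (FermionTorus 2 L))} (hψ : star ψ ⬝ᵥ ψ = 1) (hφ : star φ ⬝ᵥ φ = 1)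
    (hψgs : IsGroundStateInSector (hubbardTorus 2 L 1 U) (2 * n) 0 ψ)
    (hφgs : IsGroundStateInSector (hubbardTorus 2 L 1 0 - (((c + s₁) / (L : ℝ) ^ 2 : ℝ) : ℂ) • ((pairField dWaveFormFactor L)ᴴ * pairField dWaveFormFactor L)) (2 * n) 0 φ)
    (hdom : (expect ((pairField dWaveFormFactor L)ᴴ * pairField dWaveFormFactor L) φ).re ≤
      (expect ((pairField dWaveFormFactor L)ᴴ * pairField dWaveFormFactor L) ψ).re + ε * (L : ℝ) ^ 4) :
    ∀ s ∈ Set.Ioc (0 : ℝ) s₁,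
      (Matrix.minEnergyOn (hubbardTorus 2 L 1 0 - ((c / (L : ℝ) ^ 2 : ℝ) : ℂ) • ((pairField dWaveFormFactor L)ᴴ * pairField dWaveFormFactor L)) (szSector (2 * n) 0))
        - (Matrix.minEnergyOn (hubbardTorus 2 L 1 0 - (((c + s) / (L : ℝ) ^ 2 : ℝ) : ℂ) • ((pairField dWaveFormFactor L)ᴴ * pairField dWaveFormFactor L)) (szSector (2 * n) 0))
        - ε * s * (L : ℝ) ^ 2 ≤
      (Matrix.minEnergyOn (hubbardTorus 2 L 1 U) (szSector (2 * n) 0))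
        - (Matrix.minEnergyOn (hubbardTorus 2 L 1 U - ((s / (L : ℝ) ^ 2 : ℝ) : ℂ) • ((pairField dWaveFormFactor L)ᴴ * pairField dWaveFormFactor L)) (szSector (2 * n) 0)) := by
  intro s hs
  have hL : (0 : ℝ) < (L : ℝ) ^ 2 := by
    have := NeZero.pos L
    positivity
  have hn : n ≤ Fintype.card (FermionTorus 2 L) := le_card_of_mem_szSector L hψgs.1 hψgs.2.1
  -- a ground state of the free edge at the intermediate seed `c + s`, dominated by `φ` (monotonicity in the seed)
  have hex : ∃ φ' : Fock (Orb (FermionTorus 2 L)), star φ' ⬝ᵥ φ' = 1 ∧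
      IsGroundStateInSector (hubbardTorus 2 L 1 0 - (((c + s) / (L : ℝ) ^ 2 : ℝ) : ℂ) • ((pairField dWaveFormFactor L)ᴴ * pairField dWaveFormFactor L)) (2 * n) 0 φ' ∧
      (expect ((pairField dWaveFormFactor L)ᴴ * pairField dWaveFormFactor L) φ').re ≤
        (expect ((pairField dWaveFormFactor L)ᴴ * pairField dWaveFormFactor L) φ).re := by
    rcases eq_or_lt_of_le hs.2 with h | h
    · subst h
      exact ⟨φ, hφ, hφgs, le_rfl⟩
    · obtain ⟨φ', hφ', hφ'gs⟩ := exists_unit_groundState 0 (c + s) L hn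
      exact ⟨φ', hφ', hφ'gs, expect_pairIntensity_mono (U := 0) (by linarith) hφ' hφ hφ'gs hφgs⟩
  obtain ⟨φ', hφ', hφ'gs, hmono⟩ := hex
  -- left chord on the free edge, from `c` to `c + s`
  have hleft := leftChord_le_order (U := 0) (g := c + s) (g' := c) (by linarith [hs.1]) hφ' hφ'gs
  -- right chord at the pure corner, from `0` to `s`
  have hgs0 : IsGroundStateInSector (hubbardTorus 2 L 1 U - ((0 / (L : ℝ) ^ 2 : ℝ) : ℂ) • ((pairField dWaveFormFactor L)ᴴ * pairField dWaveFormFactor L)) (2 * n) 0 ψ := by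
    rw [seededH_zero]
    exact hψgs
  have hright := order_le_rightChord (U := U) (g := 0) (g'' := s) hs.1 hψ hgs0
  rw [seededH_zero] at hright
  -- bookkeeping
  have e1 : (c + s - c) / (L : ℝ) ^ 2 * (expect ((pairField dWaveFormFactor L)ᴴ * pairField dWaveFormFactor L) φ').re =
      s / (L : ℝ) ^ 2 * (expect ((pairField dWaveFormFactor L)ᴴ * pairField dWaveFormFactor L) φ').re := by
    ring_nf
  have e2 : (s - 0) / (L : ℝ) ^ 2 * (expect ((pairField dWaveFormFactor L)ᴴ * pairField dWaveFormFactor L) ψ).re =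
      s / (L : ℝ) ^ 2 * (expect ((pairField dWaveFormFactor L)ᴴ * pairField dWaveFormFactor L) ψ).re := by
    rw [sub_zero]
  have key : s / (L : ℝ) ^ 2 * (expect ((pairField dWaveFormFactor L)ᴴ * pairField dWaveFormFactor L) φ').re ≤
      s / (L : ℝ) ^ 2 * ((expect ((pairField dWaveFormFactor L)ᴴ * pairField dWaveFormFactor L) ψ).re + ε * (L : ℝ) ^ 4) :=
    mul_le_mul_of_nonneg_left (hmono.trans hdom) (div_nonneg hs.1.le hL.le)
  have e3 : s / (L : ℝ) ^ 2 * ((expect ((pairField dWaveFormFactor L)ᴴ * pairField dWaveFormFactor L) ψ).re + ε * (L : ℝ) ^ 4) =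
      s / (L : ℝ) ^ 2 * (expect ((pairField dWaveFormFactor L)ᴴ * pairField dWaveFormFactor L) ψ).re + ε * s * (L : ℝ) ^ 2 := by
    field_simp
  linarith

/-- **Strip transport ⇒ order dominance at the bottom seed.** If
`E_L(0,c) − E_L(0,c+s) − ε s L² ≤ E_L(U,0) − E_L(U,s)` for all `s ∈ (0,s₁]` (`s₁ > 0`), then for every
normalised sector ground state `φ` of the free seeded torus at seed `c` there is a normalised sector ground state
`ψ` of the pure torus `hubbardTorus 2 L 1 U` with `re⟨φ,P_Lφ⟩ ≤ re⟨ψ,P_Lψ⟩ + εL⁴` (right chord at `c` on the free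
edge, then Danskin attainment `stub_danskinAttainment` at the pure corner). [folklore] -/
theorem orderDominance_of_transport {L : ℕ} [NeZero L] {U c s₁ ε : ℝ} {n : ℕ} (hs₁ : 0 < s₁)
    (hT : ∀ s ∈ Set.Ioc (0 : ℝ) s₁,
      (Matrix.minEnergyOn (hubbardTorus 2 L 1 0 - ((c / (L : ℝ) ^ 2 : ℝ) : ℂ) • ((pairField dWaveFormFactor L)ᴴ * pairField dWaveFormFactor L)) (szSector (2 * n) 0))
        - (Matrix.minEnergyOn (hubbardTorus 2 L 1 0 - (((c + s) / (L : ℝ) ^ 2 : ℝ) : ℂ) • ((pairField dWaveFormFactor L)ᴴ * pairField dWaveFormFactor L)) (szSector (2 * n) 0))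
        - ε * s * (L : ℝ) ^ 2 ≤
      (Matrix.minEnergyOn (hubbardTorus 2 L 1 U) (szSector (2 * n) 0))
        - (Matrix.minEnergyOn (hubbardTorus 2 L 1 U - ((s / (L : ℝ) ^ 2 : ℝ) : ℂ) • ((pairField dWaveFormFactor L)ᴴ * pairField dWaveFormFactor L)) (szSector (2 * n) 0)))
    {φ : Fock (Orb (FermionTorus 2 L))} (hφ : star φ ⬝ᵥ φ = 1)
    (hφgs : IsGroundStateInSector (hubbardTorus 2 L 1 0 - ((c / (L : ℝ) ^ 2 : ℝ) : ℂ) • ((pairField dWaveFormFactor L)ᴴ * pairField dWaveFormFactor L)) (2 * n) 0 φ) :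
    ∃ ψ : Fock (Orb (FermionTorus 2 L)), star ψ ⬝ᵥ ψ = 1 ∧ IsGroundStateInSector (hubbardTorus 2 L 1 U) (2 * n) 0 ψ ∧
      (expect ((pairField dWaveFormFactor L)ᴴ * pairField dWaveFormFactor L) φ).re ≤
        (expect ((pairField dWaveFormFactor L)ᴴ * pairField dWaveFormFactor L) ψ).re + ε * (L : ℝ) ^ 4 := by
  have hL : (0 : ℝ) < (L : ℝ) ^ 2 := by
    have := NeZero.pos L
    positivity
  have hn : n ≤ Fintype.card (FermionTorus 2 L) := le_card_of_mem_szSector L hφgs.1 hφgs.2.1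
  -- the linear gain bound at the pure corner with slope `B = (re⟨φ,P_Lφ⟩ − εL⁴)/L²`
  have hB : ∀ s ∈ Set.Ioo (0 : ℝ) s₁,
      ((expect ((pairField dWaveFormFactor L)ᴴ * pairField dWaveFormFactor L) φ).re - ε * (L : ℝ) ^ 4) / (L : ℝ) ^ 2 * s ≤
        (Matrix.minEnergyOn (hubbardTorus 2 L 1 U) (szSector (2 * n) 0))
          - (Matrix.minEnergyOn (hubbardTorus 2 L 1 U - ((s / (L : ℝ) ^ 2 : ℝ) : ℂ) • ((pairField dWaveFormFactor L)ᴴ * pairField dWaveFormFactor L)) (szSector (2 * n) 0)) := by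
    intro s hs
    have hright := order_le_rightChord (U := 0) (g := c) (g'' := c + s) (by linarith [hs.1]) hφ hφgs
    have ht := hT s ⟨hs.1, hs.2.le⟩
    have e1 : ((expect ((pairField dWaveFormFactor L)ᴴ * pairField dWaveFormFactor L) φ).re - ε * (L : ℝ) ^ 4) / (L : ℝ) ^ 2 * s =
        (c + s - c) / (L : ℝ) ^ 2 * (expect ((pairField dWaveFormFactor L)ᴴ * pairField dWaveFormFactor L) φ).re - ε * s * (L : ℝ) ^ 2 := by
      field_simp
      ring
    linarith
  obtain ⟨ψ, hψ, hgs, hBψ⟩ := stub_danskinAttainment L U n _ s₁ hn hs₁ hB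
  refine ⟨ψ, hψ, hgs, ?_⟩
  have e2 : ((expect ((pairField dWaveFormFactor L)ᴴ * pairField dWaveFormFactor L) φ).re - ε * (L : ℝ) ^ 4) / (L : ℝ) ^ 2 * (L : ℝ) ^ 2 =
      (expect ((pairField dWaveFormFactor L)ᴴ * pairField dWaveFormFactor L) φ).re - ε * (L : ℝ) ^ 4 :=
    div_mul_cancel₀ _ hL.ne'
  linarith

/-- **The stub from order dominance** (quantified form of `transport_of_orderDominance`): if at one doping of
`[1/10,3/10]` and for all small `U`, eventually in even `L`, SOME normalised sector ground state of the pure torus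
dominates (up to `εL⁴`) the pair intensity of SOME normalised ground state of the free seeded torus at the top
seed `aU² + s₁`, then the lead's `stub_isogapTransport` holds. [folklore] -/
theorem stub_isogapTransport_of_orderDominance :
    (∃ δ ∈ Set.Icc (1 / 10 : ℝ) (3 / 10), ∃ U₁ a : ℝ, 0 < U₁ ∧ 0 < a ∧ ∀ U ∈ Set.Ioc (0 : ℝ) U₁, ∃ s₁ : ℝ, 0 < s₁ ∧
      ∀ ε : ℝ, 0 < ε → ∃ L₀ : ℕ, ∀ (L : ℕ) [NeZero L], L₀ ≤ L → Even L →
        ∃ ψ φ : Fock (Orb (FermionTorus 2 L)), star ψ ⬝ᵥ ψ = 1 ∧ star φ ⬝ᵥ φ = 1 ∧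
          IsGroundStateInSector (hubbardTorus 2 L 1 U) (2 * ⌊(1 - δ) * (L : ℝ) ^ 2 / 2⌋₊) 0 ψ ∧
          IsGroundStateInSector (hubbardTorus 2 L 1 0 - (((a * U ^ 2 + s₁) / (L : ℝ) ^ 2 : ℝ) : ℂ) • ((pairField dWaveFormFactor L)ᴴ * pairField dWaveFormFactor L)) (2 * ⌊(1 - δ) * (L : ℝ) ^ 2 / 2⌋₊) 0 φ ∧
          (expect ((pairField dWaveFormFactor L)ᴴ * pairField dWaveFormFactor L) φ).re ≤
            (expect ((pairField dWaveFormFactor L)ᴴ * pairField dWaveFormFactor L) ψ).re + ε * (L : ℝ) ^ 4) →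
    ∃ δ ∈ Set.Icc (1 / 10 : ℝ) (3 / 10), ∃ U₁ a : ℝ, 0 < U₁ ∧ 0 < a ∧ ∀ U ∈ Set.Ioc (0 : ℝ) U₁, ∃ s₁ : ℝ, 0 < s₁ ∧
      ∀ ε : ℝ, 0 < ε → ∃ L₀ : ℕ, ∀ (L : ℕ) [NeZero L], L₀ ≤ L → Even L → ∀ s ∈ Set.Ioc (0 : ℝ) s₁,
        (Matrix.minEnergyOn (hubbardTorus 2 L 1 0 - ((a * U ^ 2 / (L : ℝ) ^ 2 : ℝ) : ℂ) • ((pairField dWaveFormFactor L)ᴴ * pairField dWaveFormFactor L)) (szSector (2 * ⌊(1 - δ) * (L : ℝ) ^ 2 / 2⌋₊) 0))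
          - (Matrix.minEnergyOn (hubbardTorus 2 L 1 0 - (((a * U ^ 2 + s) / (L : ℝ) ^ 2 : ℝ) : ℂ) • ((pairField dWaveFormFactor L)ᴴ * pairField dWaveFormFactor L)) (szSector (2 * ⌊(1 - δ) * (L : ℝ) ^ 2 / 2⌋₊) 0))
          - ε * s * (L : ℝ) ^ 2 ≤
        (Matrix.minEnergyOn (hubbardTorus 2 L 1 U) (szSector (2 * ⌊(1 - δ) * (L : ℝ) ^ 2 / 2⌋₊) 0))
          - (Matrix.minEnergyOn (hubbardTorus 2 L 1 U - ((s / (L : ℝ) ^ 2 : ℝ) : ℂ) • ((pairField dWaveFormFactor L)ᴴ * pairField dWaveFormFactor L)) (szSector (2 * ⌊(1 - δ) * (L : ℝ) ^ 2 / 2⌋₊) 0)) := by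
  intro h
  obtain ⟨δ, hδ, U₁, a, hU₁, ha, h⟩ := h
  refine ⟨δ, hδ, U₁, a, hU₁, ha, fun U hU => ?_⟩
  obtain ⟨s₁, hs₁, h⟩ := h U hU
  refine ⟨s₁, hs₁, fun ε hε => ?_⟩
  obtain ⟨L₀, h⟩ := h ε hε
  refine ⟨L₀, fun L _ hL hE s hs => ?_⟩
  obtain ⟨ψ, φ, hψ, hφ, hψgs, hφgs, hdom⟩ := h L hL hE
  exact transport_of_orderDominance hψ hφ hψgs hφgs hdom s hs

/-- **Order dominance from the stub** (quantified form of `orderDominance_of_transport`): the lead's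
`stub_isogapTransport` forces, at its doping and for all its small `U`, eventually in even `L`, that EVERY
normalised ground state of the free seeded torus at the bottom seed `aU²` is dominated (up to `εL⁴`) in pair
intensity by SOME normalised sector ground state of the pure torus — the `∃`-ground-state weak-coupling d-wave
order floor with a reduced-BCS-calibrated constant. [folklore] -/
theorem orderDominance_of_stub_isogapTransport
    (h : ∃ δ ∈ Set.Icc (1 / 10 : ℝ) (3 / 10), ∃ U₁ a : ℝ, 0 < U₁ ∧ 0 < a ∧ ∀ U ∈ Set.Ioc (0 : ℝ) U₁, ∃ s₁ : ℝ, 0 < s₁ ∧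
      ∀ ε : ℝ, 0 < ε → ∃ L₀ : ℕ, ∀ (L : ℕ) [NeZero L], L₀ ≤ L → Even L → ∀ s ∈ Set.Ioc (0 : ℝ) s₁,
        (Matrix.minEnergyOn (hubbardTorus 2 L 1 0 - ((a * U ^ 2 / (L : ℝ) ^ 2 : ℝ) : ℂ) • ((pairField dWaveFormFactor L)ᴴ * pairField dWaveFormFactor L)) (szSector (2 * ⌊(1 - δ) * (L : ℝ) ^ 2 / 2⌋₊) 0))
          - (Matrix.minEnergyOn (hubbardTorus 2 L 1 0 - (((a * U ^ 2 + s) / (L : ℝ) ^ 2 : ℝ) : ℂ) • ((pairField dWaveFormFactor L)ᴴ * pairField dWaveFormFactor L)) (szSector (2 * ⌊(1 - δ) * (L : ℝ) ^ 2 / 2⌋₊) 0))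
          - ε * s * (L : ℝ) ^ 2 ≤
        (Matrix.minEnergyOn (hubbardTorus 2 L 1 U) (szSector (2 * ⌊(1 - δ) * (L : ℝ) ^ 2 / 2⌋₊) 0))
          - (Matrix.minEnergyOn (hubbardTorus 2 L 1 U - ((s / (L : ℝ) ^ 2 : ℝ) : ℂ) • ((pairField dWaveFormFactor L)ᴴ * pairField dWaveFormFactor L)) (szSector (2 * ⌊(1 - δ) * (L : ℝ) ^ 2 / 2⌋₊) 0))) :
    ∃ δ ∈ Set.Icc (1 / 10 : ℝ) (3 / 10), ∃ U₁ a : ℝ, 0 < U₁ ∧ 0 < a ∧ ∀ U ∈ Set.Ioc (0 : ℝ) U₁,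
      ∀ ε : ℝ, 0 < ε → ∃ L₀ : ℕ, ∀ (L : ℕ) [NeZero L], L₀ ≤ L → Even L →
        ∀ φ : Fock (Orb (FermionTorus 2 L)), star φ ⬝ᵥ φ = 1 →
          IsGroundStateInSector (hubbardTorus 2 L 1 0 - ((a * U ^ 2 / (L : ℝ) ^ 2 : ℝ) : ℂ) • ((pairField dWaveFormFactor L)ᴴ * pairField dWaveFormFactor L)) (2 * ⌊(1 - δ) * (L : ℝ) ^ 2 / 2⌋₊) 0 φ →
          ∃ ψ : Fock (Orb (FermionTorus 2 L)), star ψ ⬝ᵥ ψ = 1 ∧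
            IsGroundStateInSector (hubbardTorus 2 L 1 U) (2 * ⌊(1 - δ) * (L : ℝ) ^ 2 / 2⌋₊) 0 ψ ∧
            (expect ((pairField dWaveFormFactor L)ᴴ * pairField dWaveFormFactor L) φ).re ≤
              (expect ((pairField dWaveFormFactor L)ᴴ * pairField dWaveFormFactor L) ψ).re + ε * (L : ℝ) ^ 4 := by
  obtain ⟨δ, hδ, U₁, a, hU₁, ha, h⟩ := h
  refine ⟨δ, hδ, U₁, a, hU₁, ha, fun U hU ε hε => ?_⟩
  obtain ⟨s₁, hs₁, h⟩ := h U hU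
  obtain ⟨L₀, h⟩ := h ε hε
  refine ⟨L₀, fun L _ hL hE φ hφ hφgs => ?_⟩
  exact orderDominance_of_transport hs₁ (h L hL hE) hφ hφgs

end Summit.HubbardSuperconductivity.TwTipContinuation.IsogapTransport
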